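import Summits.AtomisticToContinuum.FouriersLaw.Theorems.PhononMeanFreePathDefs
import Summits.AtomisticToContinuum.FouriersLaw.Theorems.PhononMeanFreePathCoherentDephasingRightBalance

/-!
# Line `Sketch` of crux `PhononMeanFreePath.CoherentDephasing` (stmt-AtomisticToContinuum-11810): sitewise bookkeeping

Stub `stub_siteBookkeeping_of_meanField` of the lead's skeleton of line `Sketch` (coherent-field Beer–Lambert) of the
crux `PhononMeanFreePath.CoherentDephasing` — the SITEWISE twin of the right energy balance
(`PhononMeanFreePathCoherentDephasingRightBalance`), over the route vocabulary of `Theorems/PhononMeanFreePathDefs.lean`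
(sections CoherentField and SiteBookkeeping: `momResp`, `posResp`, `cubeResp`, `stretchCubeResp`, `bondForceResp`,
`cohEnergyDensity`, `cohEnergy`, `harmFlux`, `siteWork`). PURE REAL ANALYSIS at fixed `N`: with `m_x, n_x, c_x` the
momentum / position / cubic responses of site `x : Fin (N+1)` and `d_b, F_b` the cubic-stretch / full-force responses of
bond `b = (b.castSucc, b.succ)`, the two hypotheses are the Duhamel equations (`n_x = ∫₀ m_x`,
`m_x = T[x=0] + ∫₀ φ_x`, `φ_x = -ω₂ n_x - lam c_x + Σ_b([b=x] - [b+1=x]) F_b - γ([x=0]+[x=N]) m_x`) and the regularity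
package (continuity, `F_b = (n_{b+1} - n_b) + β d_b`, `|m|,|n|,|c|,|d| ≤ C e^{-rt}`); the conclusions are

* the site balances `Σ_b [b+1=x] Ĵ_b + [x=0] T²/2 = Σ_b [b=x] Ĵ_b + s_x + γ([x=0]+[x=N]) ∫₀^∞ m_x²` for every site `x`,
  `Ĵ_b = harmFlux b = -½∫₀^∞ (m_b + m_{b+1})(n_{b+1} - n_b)`, `s_x = siteWork x` (`siteBalance_of_duhamel`: FTC on
  `(0, ∞)` for the site energy `e_x = ½(m_x² + ω₂ n_x²) + ¼Σ_{b ∋ x}(n_{b+1} - n_b)²`, `e_x(0) = [x=0]T²/2`,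
  `e_x(∞) = 0`, with the pointwise identity `site_balance_algebra`);
* the transport bound `harmFlux b ≤ cohEnergy b.castSucc + cohEnergy b.succ` for every bond
  (`harmFlux_le_energy_of_decay`: pointwise AM–GM `neg_half_mul_le`, the bond sitting in the energy of both its ends,
  and `integral_mono`).
-/

noncomputable section

open MeasureTheory Set Filter Topology

namespace Summit.AtomisticToContinuum.FouriersLaw.Theorems.CoherentDephasing.SiteBookkeeping

open Literature.MathematicalPhysics.KineticTheory.HeatConduction
open Summit.AtomisticToContinuum.FouriersLaw.Theorems.PhononMeanFreePath
open Summit.AtomisticToContinuum.FouriersLaw.Theorems.CoherentDephasing.RightBalance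

/-! ### The sitewise bookkeeping algebra -/

/-- **The sitewise bookkeeping identity** (pointwise in time). With the drive
`φ_x = -ω₂ n_x - lam c_x + Σ_b ([b = x] - [b+1 = x]) F_b - γ ([x=0] + [x=N]) m_x`, the split `F_b = (n_{b+1} - n_b) + β d_b`
and the symmetric harmonic current `j_b = -½(m_b + m_{b+1})(n_{b+1} - n_b)`, the raw time derivative of the site energy
`½(m_x² + ω₂ n_x²) + ¼ Σ_{b ∋ x} (n_{b+1} - n_b)²` equals `Σ_b [b+1=x] j_b - Σ_b [b=x] j_b - (lam m_x c_x +
β Σ_b ([b+1=x] - [b=x]) m_x d_b) - γ([x=0]+[x=N]) m_x²`. [folklore] -/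
theorem site_balance_algebra {N : ℕ} (ω₂ lam β γ : ℝ) (m n c φ : Fin (N + 1) → ℝ) (d F : Fin N → ℝ)
    (x : Fin (N + 1)) (hF : ∀ b : Fin N, F b = n b.succ - n b.castSucc + β * d b)
    (hφ : φ x = -(ω₂ * n x) - lam * c x +
      (∑ b : Fin N, ((if (b : ℕ) = (x : ℕ) then F b else 0) - (if (b : ℕ) + 1 = (x : ℕ) then F b else 0))) -
      γ * ((if (x : ℕ) = 0 then 1 else 0) + (if (x : ℕ) = N then 1 else 0)) * m x) :
    (φ x * m x + m x * φ x + ω₂ * (m x * n x + n x * m x)) / 2 +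
        1 / 4 * ∑ b : Fin N, (if (b : ℕ) = (x : ℕ) ∨ (b : ℕ) + 1 = (x : ℕ) then (1 : ℝ) else 0) *
          ((m b.succ - m b.castSucc) * (n b.succ - n b.castSucc) +
            (n b.succ - n b.castSucc) * (m b.succ - m b.castSucc)) =
      -(1 / 2 * (∑ b : Fin N, (if (b : ℕ) + 1 = (x : ℕ) then (1 : ℝ) else 0) *
            ((m b.castSucc + m b.succ) * (n b.succ - n b.castSucc))) -
          1 / 2 * (∑ b : Fin N, (if (b : ℕ) = (x : ℕ) then (1 : ℝ) else 0) *
            ((m b.castSucc + m b.succ) * (n b.succ - n b.castSucc))) +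
          (lam * (m x * c x) + β * ∑ b : Fin N, ((if (b : ℕ) + 1 = (x : ℕ) then (1 : ℝ) else 0) -
            (if (b : ℕ) = (x : ℕ) then 1 else 0)) * (m x * d b)) +
          γ * ((if (x : ℕ) = 0 then 1 else 0) + (if (x : ℕ) = N then 1 else 0)) * m x ^ 2) := by
  -- bond by bond, everything cancels
  have key : ∀ b : Fin N,
      m x * ((if (b : ℕ) = (x : ℕ) then F b else 0) - (if (b : ℕ) + 1 = (x : ℕ) then F b else 0)) +
        1 / 4 * ((if (b : ℕ) = (x : ℕ) ∨ (b : ℕ) + 1 = (x : ℕ) then (1 : ℝ) else 0) *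
          ((m b.succ - m b.castSucc) * (n b.succ - n b.castSucc) +
            (n b.succ - n b.castSucc) * (m b.succ - m b.castSucc))) +
        1 / 2 * ((if (b : ℕ) + 1 = (x : ℕ) then (1 : ℝ) else 0) *
          ((m b.castSucc + m b.succ) * (n b.succ - n b.castSucc))) -
        1 / 2 * ((if (b : ℕ) = (x : ℕ) then (1 : ℝ) else 0) *
          ((m b.castSucc + m b.succ) * (n b.succ - n b.castSucc))) +
        β * (((if (b : ℕ) + 1 = (x : ℕ) then (1 : ℝ) else 0) - (if (b : ℕ) = (x : ℕ) then 1 else 0)) *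
          (m x * d b)) = 0 := by
    intro b
    by_cases h1 : (b : ℕ) = (x : ℕ)
    · have h2 : ¬((b : ℕ) + 1 = (x : ℕ)) := by omega
      have hx : x = b.castSucc := Fin.ext (by rw [Fin.val_castSucc]; omega)
      simp only [if_pos h1, if_neg h2, if_pos (Or.inl h1 : (b : ℕ) = (x : ℕ) ∨ (b : ℕ) + 1 = (x : ℕ))]
      rw [hx, hF]; ring
    · by_cases h2 : (b : ℕ) + 1 = (x : ℕ)
      · have hx : x = b.succ := Fin.ext (by rw [Fin.val_succ]; omega)
        simp only [if_neg h1, if_pos h2, if_pos (Or.inr h2 : (b : ℕ) = (x : ℕ) ∨ (b : ℕ) + 1 = (x : ℕ))]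
        rw [hx, hF]; ring
      · simp only [if_neg h1, if_neg h2, if_neg (not_or.mpr ⟨h1, h2⟩)]
        ring
  have hsum := Finset.sum_eq_zero fun b (_ : b ∈ (Finset.univ : Finset (Fin N))) => key b
  rw [Finset.sum_add_distrib, Finset.sum_sub_distrib, Finset.sum_add_distrib, Finset.sum_add_distrib,
    ← Finset.mul_sum, ← Finset.mul_sum, ← Finset.mul_sum, ← Finset.mul_sum, ← Finset.mul_sum] at hsum
  rw [hφ]
  linear_combination hsum

/-- **AM–GM for the symmetric harmonic current**: `-½(a + a')δ ≤ (a² + ω₂u²)/2 + S/4 + (a'² + ω₂u'²)/2 + S'/4` as soon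
as `δ² ≤ S`, `δ² ≤ S'`, `0 ≤ ω₂` (`|j_b| ≤ e_b + e_{b+1}` pointwise). [folklore] -/
theorem neg_half_mul_le {a a' δ u u' S S' ω₂ : ℝ} (hω : 0 ≤ ω₂) (hS : δ ^ 2 ≤ S) (hS' : δ ^ 2 ≤ S') :
    -(1 / 2) * ((a + a') * δ) ≤ (a ^ 2 + ω₂ * u ^ 2) / 2 + 1 / 4 * S + ((a' ^ 2 + ω₂ * u' ^ 2) / 2 + 1 / 4 * S') := by
  nlinarith [mul_nonneg hω (sq_nonneg u), mul_nonneg hω (sq_nonneg u'), sq_nonneg (a + a' + δ), sq_nonneg (a - a')]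

/-- A non-negative family dominates each of its members selected by an indicator sum. [folklore] -/
theorem le_sum_ite {ι : Type*} [Fintype ι] (p : ι → Prop) [DecidablePred p] (g : ι → ℝ) (hg : ∀ i, 0 ≤ g i)
    (i : ι) (hi : p i) : g i ≤ ∑ j, if p j then g j else 0 := by
  have h := Finset.single_le_sum (f := fun j => if p j then g j else 0) (s := Finset.univ)
    (fun j _ => by split_ifs; exacts [hg j, le_rfl]) (Finset.mem_univ i)
  beta_reduce at h
  rwa [if_pos hi] at h

/-! ### The site balances for an abstract solution of the mean-field equations -/

/-- **Site energy balance, abstract form.** Let `m_x, n_x, c_x` (`x : Fin (N+1)`) and `d_b, F_b` (`b : Fin N`) be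
continuous with `|m|, |n|, |c|, |d| ≤ C e^{-rt}` on `t ≥ 0` (`r > 0`), `F_b = (n_{b+1} - n_b) + β d_b`, solving for
`t ≥ 0` the Duhamel equations `n_x(t) = ∫₀ᵗ m_x`,
`m_x(t) = T[x=0] + ∫₀ᵗ (-ω₂ n_x - lam c_x + Σ_b([b=x] - [b+1=x]) F_b - γ([x=0]+[x=N]) m_x)`; let
`J_b = -½∫₀^∞ (m_b + m_{b+1})(n_{b+1} - n_b)` and `S_x = lam ∫₀^∞ m_x c_x + β Σ_b ([b+1=x] - [b=x]) ∫₀^∞ m_x d_b`. Then at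
every site `x`: `Σ_b [b+1=x] J_b + [x=0] T²/2 = Σ_b [b=x] J_b + S_x + γ([x=0]+[x=N]) ∫₀^∞ m_x²` (FTC for the site energy
`½(m_x² + ω₂ n_x²) + ¼Σ_{b ∋ x}(n_{b+1} - n_b)²`, which is `[x=0]T²/2` at `t = 0` and `0` at `t = ∞`). [folklore] -/
theorem siteBalance_of_duhamel {N : ℕ} {ω₂ lam β γ T : ℝ} {m n c : Fin (N + 1) → ℝ → ℝ}
    {d F : Fin N → ℝ → ℝ}
    (hn : ∀ (x : Fin (N + 1)) (t : ℝ), 0 ≤ t → n x t = ∫ s in (0 : ℝ)..t, m x s)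
    (hm : ∀ (x : Fin (N + 1)) (t : ℝ), 0 ≤ t → m x t = (if (x : ℕ) = 0 then T else 0) +
      ∫ s in (0 : ℝ)..t, (-(ω₂ * n x s) - lam * c x s +
        (∑ b : Fin N, ((if (b : ℕ) = (x : ℕ) then F b s else 0) -
          (if (b : ℕ) + 1 = (x : ℕ) then F b s else 0))) -
        γ * ((if (x : ℕ) = 0 then 1 else 0) + (if (x : ℕ) = N then 1 else 0)) * m x s))
    (hmc : ∀ x, Continuous (m x)) (hnc : ∀ x, Continuous (n x)) (hcc : ∀ x, Continuous (c x))
    (hdc : ∀ b, Continuous (d b))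
    (hF : ∀ (b : Fin N) (t : ℝ), F b t = n b.succ t - n b.castSucc t + β * d b t)
    {C r : ℝ} (hr : 0 < r)
    (hmb : ∀ (x : Fin (N + 1)) (t : ℝ), 0 ≤ t → |m x t| ≤ C * Real.exp (-r * t))
    (hnb : ∀ (x : Fin (N + 1)) (t : ℝ), 0 ≤ t → |n x t| ≤ C * Real.exp (-r * t))
    (hcb : ∀ (x : Fin (N + 1)) (t : ℝ), 0 ≤ t → |c x t| ≤ C * Real.exp (-r * t))
    (hdb : ∀ (b : Fin N) (t : ℝ), 0 ≤ t → |d b t| ≤ C * Real.exp (-r * t))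
    {J : Fin N → ℝ} (hJ : ∀ b : Fin N, J b = -(1 / 2) * ∫ t in Ioi (0 : ℝ),
      (m b.castSucc t + m b.succ t) * (n b.succ t - n b.castSucc t))
    {S : Fin (N + 1) → ℝ} (hS : ∀ x : Fin (N + 1), S x = lam * (∫ t in Ioi (0 : ℝ), m x t * c x t) +
      β * ∑ b : Fin N, ((if (b : ℕ) + 1 = (x : ℕ) then (1 : ℝ) else 0) - (if (b : ℕ) = (x : ℕ) then 1 else 0)) *
        ∫ t in Ioi (0 : ℝ), m x t * d b t)
    (x : Fin (N + 1)) :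
    (∑ b : Fin N, if (b : ℕ) + 1 = (x : ℕ) then J b else 0) + (if (x : ℕ) = 0 then T ^ 2 / 2 else 0) =
      (∑ b : Fin N, if (b : ℕ) = (x : ℕ) then J b else 0) + S x +
        γ * ((if (x : ℕ) = 0 then 1 else 0) + (if (x : ℕ) = N then 1 else 0)) *
          ∫ t in Ioi (0 : ℝ), m x t ^ 2 := by
  -- the drive `φ_x` of the momentum equation, continuity, derivatives on `(0, ∞)`
  obtain ⟨φ, hφ⟩ : ∃ φ : Fin (N + 1) → ℝ → ℝ, ∀ x s, φ x s = -(ω₂ * n x s) - lam * c x s +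
      (∑ b : Fin N, ((if (b : ℕ) = (x : ℕ) then F b s else 0) -
        (if (b : ℕ) + 1 = (x : ℕ) then F b s else 0))) -
      γ * ((if (x : ℕ) = 0 then 1 else 0) + (if (x : ℕ) = N then 1 else 0)) * m x s :=
    ⟨_, fun _ _ => rfl⟩
  have hFc : ∀ b', Continuous (F b') := fun b' => by
    rw [show F b' = fun t => n b'.succ t - n b'.castSucc t + β * d b' t from funext (hF b')]
    fun_prop
  have hφc : ∀ x, Continuous (φ x) := fun x => by
    rw [show φ x = _ from funext (hφ x)]
    exact ((((hnc x).const_mul ω₂).neg.sub ((hcc x).const_mul lam)).add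
      (continuous_finsetSum _ fun b' _ => ((hFc b').if_const _ continuous_const).sub
        ((hFc b').if_const _ continuous_const))).sub (continuous_const.mul (hmc x))
  have hdn : ∀ (x : Fin (N + 1)) (t : ℝ), 0 < t → HasDerivAt (n x) (m x t) t := fun x t ht =>
    ((hmc x).integral_hasStrictDerivAt 0 t).hasDerivAt.congr_of_eventuallyEq
      ((lt_mem_nhds ht).mono fun u hu => hn x u hu.le)
  have hdm : ∀ (x : Fin (N + 1)) (t : ℝ), 0 < t → HasDerivAt (m x) (φ x t) t := fun x t ht => by
    refine (((hφc x).integral_hasStrictDerivAt 0 t).hasDerivAt.const_add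
      (if (x : ℕ) = 0 then T else 0)).congr_of_eventuallyEq ((lt_mem_nhds ht).mono fun u hu => ?_)
    rw [hm x u hu.le]
    simp only [hφ]
  -- integrability of the products on `(0, ∞)`
  have ik : ∀ b : Fin N, IntegrableOn
      (fun t => (m b.castSucc t + m b.succ t) * (n b.succ t - n b.castSucc t)) (Ioi 0) := fun b =>
    integrableOn_Ioi_of_abs_le_exp hr (((hmc _).add (hmc _)).mul ((hnc _).sub (hnc _)))
      fun t ht => abs_mul_le_of_abs_le_exp hr ht (abs_add_le_of_abs_le (hmb _ t ht) (hmb _ t ht))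
        (abs_sub_le_of_abs_le (hnb _ t ht) (hnb _ t ht))
  have imc : IntegrableOn (fun t => m x t * c x t) (Ioi 0) :=
    integrableOn_Ioi_of_abs_le_exp hr ((hmc x).mul (hcc x))
      fun t ht => abs_mul_le_of_abs_le_exp hr ht (hmb x t ht) (hcb x t ht)
  have imd : ∀ b, IntegrableOn (fun t => m x t * d b t) (Ioi 0) := fun b =>
    integrableOn_Ioi_of_abs_le_exp hr ((hmc x).mul (hdc b))
      fun t ht => abs_mul_le_of_abs_le_exp hr ht (hmb x t ht) (hdb b t ht)
  have im2 : IntegrableOn (fun t => m x t ^ 2) (Ioi 0) := by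
    refine integrableOn_Ioi_of_abs_le_exp (K := C * C) hr ((hmc _).pow 2) fun t ht => ?_
    rw [sq]
    exact abs_mul_le_of_abs_le_exp hr ht (hmb _ t ht) (hmb _ t ht)
  -- the site energy `e` and its dissipation/transfer rate `P = -e'`
  obtain ⟨e, he⟩ : ∃ e : ℝ → ℝ, e = fun t => (m x t * m x t + ω₂ * (n x t * n x t)) / 2 +
      1 / 4 * ∑ b : Fin N, (if (b : ℕ) = (x : ℕ) ∨ (b : ℕ) + 1 = (x : ℕ) then (1 : ℝ) else 0) *
        ((n b.succ t - n b.castSucc t) * (n b.succ t - n b.castSucc t)) := ⟨_, rfl⟩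
  obtain ⟨P, hP⟩ : ∃ P : ℝ → ℝ, P = fun t =>
      1 / 2 * (∑ b : Fin N, (if (b : ℕ) + 1 = (x : ℕ) then (1 : ℝ) else 0) *
          ((m b.castSucc t + m b.succ t) * (n b.succ t - n b.castSucc t))) -
        1 / 2 * (∑ b : Fin N, (if (b : ℕ) = (x : ℕ) then (1 : ℝ) else 0) *
          ((m b.castSucc t + m b.succ t) * (n b.succ t - n b.castSucc t))) +
        (lam * (m x t * c x t) + β * ∑ b : Fin N, ((if (b : ℕ) + 1 = (x : ℕ) then (1 : ℝ) else 0) -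
          (if (b : ℕ) = (x : ℕ) then 1 else 0)) * (m x t * d b t)) +
        γ * ((if (x : ℕ) = 0 then 1 else 0) + (if (x : ℕ) = N then 1 else 0)) * m x t ^ 2 := ⟨_, rfl⟩
  have hderiv : ∀ t, 0 < t → HasDerivAt e (-P t) t := by
    intro t ht
    have h1 := (((hdm x t ht).fun_mul (hdm x t ht)).fun_add
      (((hdn x t ht).fun_mul (hdn x t ht)).const_mul ω₂)).div_const 2
    have h2 := (HasDerivAt.fun_sum (u := (Finset.univ : Finset (Fin N))) fun b _ =>
      ((((hdn b.succ t ht).fun_sub (hdn b.castSucc t ht)).fun_mul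
        ((hdn b.succ t ht).fun_sub (hdn b.castSucc t ht))).const_mul
          (if (b : ℕ) = (x : ℕ) ∨ (b : ℕ) + 1 = (x : ℕ) then (1 : ℝ) else 0))).const_mul (1 / 4 : ℝ)
    rw [he, hP]
    exact (h1.fun_add h2).congr_deriv (site_balance_algebra ω₂ lam β γ (fun y => m y t) (fun y => n y t)
      (fun y => c y t) (fun y => φ y t) (fun b => d b t) (fun b => F b t) x (fun b => hF b t) (hφ x t))
  -- `e` is continuous, `e(0) = [x = 0] T²/2`, `e(∞) = 0`
  have hec : Continuous e := by
    rw [he]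
    exact ((((hmc x).mul (hmc x)).add (((hnc x).mul (hnc x)).const_mul ω₂)).div_const 2).add
      ((continuous_finsetSum _ fun b _ =>
        (((hnc _).sub (hnc _)).mul ((hnc _).sub (hnc _))).const_mul _).const_mul _)
  have he0 : e 0 = if (x : ℕ) = 0 then T ^ 2 / 2 else 0 := by
    have hn0 : ∀ y, n y 0 = 0 := fun y => by rw [hn y 0 le_rfl, intervalIntegral.integral_same]
    have hm0 : m x 0 = if (x : ℕ) = 0 then T else 0 := by
      rw [hm x 0 le_rfl, intervalIntegral.integral_same, add_zero]
    rw [he]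
    simp only [hn0, hm0, sub_self, mul_zero, Finset.sum_const_zero, add_zero]
    split_ifs <;> ring
  have het : Tendsto e atTop (𝓝 0) := by
    have hm0 : ∀ y, Tendsto (m y) atTop (𝓝 0) := fun y => tendsto_zero_of_abs_le_exp hr (hmb y)
    have hn0 : ∀ y, Tendsto (n y) atTop (𝓝 0) := fun y => tendsto_zero_of_abs_le_exp hr (hnb y)
    have := ((((hm0 x).mul (hm0 x)).add (((hn0 x).mul (hn0 x)).const_mul ω₂)).div_const 2).add
      ((tendsto_finsetSum (Finset.univ : Finset (Fin N)) fun b _ =>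
        (((hn0 b.succ).sub (hn0 b.castSucc)).mul ((hn0 b.succ).sub (hn0 b.castSucc))).const_mul
          (if (b : ℕ) = (x : ℕ) ∨ (b : ℕ) + 1 = (x : ℕ) then (1 : ℝ) else 0)).const_mul (1 / 4 : ℝ))
    rw [he]
    simpa using this
  -- `P` is integrable and `∫₀^∞ P = e(0) - e(∞)`
  have iA : IntegrableOn (fun t => 1 / 2 * ∑ b : Fin N, (if (b : ℕ) + 1 = (x : ℕ) then (1 : ℝ) else 0) *
      ((m b.castSucc t + m b.succ t) * (n b.succ t - n b.castSucc t))) (Ioi 0) :=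
    (integrable_finsetSum _ fun b _ => (ik b).const_mul _).const_mul _
  have iB : IntegrableOn (fun t => 1 / 2 * ∑ b : Fin N, (if (b : ℕ) = (x : ℕ) then (1 : ℝ) else 0) *
      ((m b.castSucc t + m b.succ t) * (n b.succ t - n b.castSucc t))) (Ioi 0) :=
    (integrable_finsetSum _ fun b _ => (ik b).const_mul _).const_mul _
  have iD : IntegrableOn (fun t => β * ∑ b : Fin N, ((if (b : ℕ) + 1 = (x : ℕ) then (1 : ℝ) else 0) -
      (if (b : ℕ) = (x : ℕ) then 1 else 0)) * (m x t * d b t)) (Ioi 0) :=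
    (integrable_finsetSum _ fun b _ => (imd b).const_mul _).const_mul _
  have hPi : IntegrableOn P (Ioi 0) := by
    rw [hP]
    exact ((iA.sub' iB).fun_add ((imc.const_mul lam).fun_add iD)).fun_add (im2.const_mul _)
  have hPint : ∫ t in Ioi (0 : ℝ), P t = if (x : ℕ) = 0 then T ^ 2 / 2 else 0 := by
    have h := integral_Ioi_of_hasDerivAt_of_tendsto (f := fun t => -e t) (m := 0)
      hec.neg.continuousWithinAt
      (fun t ht => ((hderiv t ht).fun_neg).congr_deriv (neg_neg _)) hPi (by simpa using het.neg)
    rw [h, he0, zero_sub, neg_neg]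
  have hPsplit : ∫ t in Ioi (0 : ℝ), P t =
      1 / 2 * (∑ b : Fin N, (if (b : ℕ) + 1 = (x : ℕ) then (1 : ℝ) else 0) *
          ∫ t in Ioi (0 : ℝ), (m b.castSucc t + m b.succ t) * (n b.succ t - n b.castSucc t)) -
        1 / 2 * (∑ b : Fin N, (if (b : ℕ) = (x : ℕ) then (1 : ℝ) else 0) *
          ∫ t in Ioi (0 : ℝ), (m b.castSucc t + m b.succ t) * (n b.succ t - n b.castSucc t)) + S x +
        γ * ((if (x : ℕ) = 0 then 1 else 0) + (if (x : ℕ) = N then 1 else 0)) *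
          ∫ t in Ioi (0 : ℝ), m x t ^ 2 := by
    rw [hP, hS]
    simp only
    rw [integral_add ((iA.sub' iB).fun_add ((imc.const_mul lam).fun_add iD)) (im2.const_mul _),
      integral_add (iA.sub' iB) ((imc.const_mul lam).fun_add iD), integral_sub iA iB,
      integral_add (imc.const_mul lam) iD, integral_const_mul, integral_const_mul, integral_const_mul,
      integral_const_mul, integral_const_mul, integral_finsetSum _ fun b _ => (ik b).const_mul _,
      integral_finsetSum _ fun b _ => (ik b).const_mul _, integral_finsetSum _ fun b _ => (imd b).const_mul _]
    simp only [integral_const_mul]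
  -- read off the balance
  have e1 : (∑ b : Fin N, if (b : ℕ) + 1 = (x : ℕ) then J b else 0) =
      -(1 / 2) * ∑ b : Fin N, (if (b : ℕ) + 1 = (x : ℕ) then (1 : ℝ) else 0) *
        ∫ t in Ioi (0 : ℝ), (m b.castSucc t + m b.succ t) * (n b.succ t - n b.castSucc t) := by
    rw [Finset.mul_sum]
    refine Finset.sum_congr rfl fun b _ => ?_
    split_ifs <;> simp [hJ]
  have e2 : (∑ b : Fin N, if (b : ℕ) = (x : ℕ) then J b else 0) =
      -(1 / 2) * ∑ b : Fin N, (if (b : ℕ) = (x : ℕ) then (1 : ℝ) else 0) *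
        ∫ t in Ioi (0 : ℝ), (m b.castSucc t + m b.succ t) * (n b.succ t - n b.castSucc t) := by
    rw [Finset.mul_sum]
    refine Finset.sum_congr rfl fun b _ => ?_
    split_ifs <;> simp [hJ]
  rw [e1, e2]
  linarith

/-- **Transport bound, abstract form**: for continuous `m, n` with `|m|, |n| ≤ C e^{-rt}` (`r > 0`) on `t ≥ 0` and
`ω₂ ≥ 0`, the symmetric harmonic flux through bond `b` is at most the time-integrated site energies of its two ends,
`-½∫₀^∞ (m_b + m_{b+1})(n_{b+1} - n_b) ≤ ∫₀^∞ e_b + ∫₀^∞ e_{b+1}`,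
`e_y = ½(m_y² + ω₂ n_y²) + ¼ Σ_{b' ∋ y} (n_{b'+1} - n_{b'})²` (pointwise AM–GM `neg_half_mul_le`; bond `b` sits in the
sums of both of its ends). [folklore] -/
theorem harmFlux_le_energy_of_decay {N : ℕ} {ω₂ : ℝ} (hω : 0 ≤ ω₂) {m n : Fin (N + 1) → ℝ → ℝ}
    (hmc : ∀ x, Continuous (m x)) (hnc : ∀ x, Continuous (n x)) {C r : ℝ} (hr : 0 < r)
    (hmb : ∀ (x : Fin (N + 1)) (t : ℝ), 0 ≤ t → |m x t| ≤ C * Real.exp (-r * t))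
    (hnb : ∀ (x : Fin (N + 1)) (t : ℝ), 0 ≤ t → |n x t| ≤ C * Real.exp (-r * t))
    {eD : Fin (N + 1) → ℝ → ℝ} (heD : ∀ (y : Fin (N + 1)) (t : ℝ), eD y t =
      (m y t ^ 2 + ω₂ * n y t ^ 2) / 2 + (1 / 4) * ∑ b' : Fin N,
        if (b' : ℕ) = (y : ℕ) ∨ (b' : ℕ) + 1 = (y : ℕ) then (n b'.succ t - n b'.castSucc t) ^ 2 else 0)
    (b : Fin N) :
    -(1 / 2) * ∫ t in Ioi (0 : ℝ), (m b.castSucc t + m b.succ t) * (n b.succ t - n b.castSucc t) ≤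
      (∫ t in Ioi (0 : ℝ), eD b.castSucc t) + ∫ t in Ioi (0 : ℝ), eD b.succ t := by
  have i2 : ∀ f : ℝ → ℝ, Continuous f → (∀ t, 0 ≤ t → |f t| ≤ (C + C) * Real.exp (-r * t)) →
      IntegrableOn (fun t => f t ^ 2) (Ioi 0) := fun f hf hb => by
    refine integrableOn_Ioi_of_abs_le_exp (K := (C + C) * (C + C)) hr (hf.pow 2) fun t ht => ?_
    rw [sq]
    exact abs_mul_le_of_abs_le_exp hr ht (hb t ht) (hb t ht)
  have hC : ∀ (f : ℝ → ℝ) (t : ℝ), |f t| ≤ C * Real.exp (-r * t) → |f t| ≤ (C + C) * Real.exp (-r * t) :=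
    fun f t h => h.trans (by nlinarith [(abs_nonneg _).trans h, Real.exp_pos (-r * t)])
  have ie : ∀ y, IntegrableOn (eD y) (Ioi 0) := fun y => by
    rw [show eD y = fun t => _ from funext (heD y)]
    refine (((i2 _ (hmc y) fun t ht => hC _ t (hmb y t ht)).fun_add
      ((i2 _ (hnc y) fun t ht => hC _ t (hnb y t ht)).const_mul ω₂)).div_const 2).fun_add
      ((integrable_finsetSum _ fun b' _ => ?_).const_mul (1 / 4))
    by_cases h : (b' : ℕ) = (y : ℕ) ∨ (b' : ℕ) + 1 = (y : ℕ)
    · simp only [if_pos h]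
      exact i2 _ ((hnc _).sub (hnc _)) fun t ht => abs_sub_le_of_abs_le (hnb _ t ht) (hnb _ t ht)
    · simp only [if_neg h]
      exact integrable_zero _ _ _
  have ik : IntegrableOn (fun t => (m b.castSucc t + m b.succ t) * (n b.succ t - n b.castSucc t)) (Ioi 0) :=
    integrableOn_Ioi_of_abs_le_exp hr (((hmc _).add (hmc _)).mul ((hnc _).sub (hnc _)))
      fun t ht => abs_mul_le_of_abs_le_exp hr ht (abs_add_le_of_abs_le (hmb _ t ht) (hmb _ t ht))
        (abs_sub_le_of_abs_le (hnb _ t ht) (hnb _ t ht))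
  have hpt : ∀ t, -(1 / 2) * ((m b.castSucc t + m b.succ t) * (n b.succ t - n b.castSucc t)) ≤
      eD b.castSucc t + eD b.succ t := by
    intro t
    rw [heD, heD]
    exact neg_half_mul_le hω
      (le_sum_ite (fun b' : Fin N => (b' : ℕ) = ((b.castSucc : Fin (N + 1)) : ℕ) ∨
          (b' : ℕ) + 1 = ((b.castSucc : Fin (N + 1)) : ℕ)) (fun b' => (n b'.succ t - n b'.castSucc t) ^ 2)
        (fun _ => sq_nonneg _) b (Or.inl (Fin.val_castSucc b).symm))
      (le_sum_ite (fun b' : Fin N => (b' : ℕ) = ((b.succ : Fin (N + 1)) : ℕ) ∨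
          (b' : ℕ) + 1 = ((b.succ : Fin (N + 1)) : ℕ)) (fun b' => (n b'.succ t - n b'.castSucc t) ^ 2)
        (fun _ => sq_nonneg _) b (Or.inr (Fin.val_succ b).symm))
  calc -(1 / 2) * ∫ t in Ioi (0 : ℝ), (m b.castSucc t + m b.succ t) * (n b.succ t - n b.castSucc t)
      = ∫ t in Ioi (0 : ℝ), -(1 / 2) * ((m b.castSucc t + m b.succ t) * (n b.succ t - n b.castSucc t)) :=
        (integral_const_mul _ _).symm
    _ ≤ ∫ t in Ioi (0 : ℝ), (eD b.castSucc t + eD b.succ t) :=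
        integral_mono (ik.const_mul _) ((ie _).fun_add (ie _)) hpt
    _ = (∫ t in Ioi (0 : ℝ), eD b.castSucc t) + ∫ t in Ioi (0 : ℝ), eD b.succ t := integral_add (ie _) (ie _)

/-! ### The registered stub of line `Sketch` -/

/-- **Sitewise bookkeeping from the mean-field equations** (stub `stub_siteBookkeeping_of_meanField` of line `Sketch` of
crux `PhononMeanFreePath.CoherentDephasing`, fixed `N`, pure real analysis). At one admissible parameter point and one
`N`, the Duhamel equations of the coherent response field and the continuity / linearity / decay package imply the site
energy balances `Σ_b [b+1=x] harmFlux b + [x=0] T²/2 = Σ_b [b=x] harmFlux b + siteWork x + γ([x=0]+[x=N]) ∫₀^∞ m_x²`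
at every site and the transport bound `harmFlux b ≤ cohEnergy b.castSucc + cohEnergy b.succ` at every bond
(`siteBalance_of_duhamel`, `harmFlux_le_energy_of_decay` read through the route vocabulary). [folklore] -/
theorem stub_siteBookkeeping_of_meanField :
    ∀ ω₂ lam β γ : ℝ, 0 < ω₂ → 0 < lam → 0 < β → 0 < γ → ∀ T : ℝ, 0 < T → ∀ N : ℕ,
      ((∀ (x : Fin (N + 1)) (t : ℝ), 0 ≤ t →
          posResp ω₂ lam β γ T N x t = ∫ s in (0 : ℝ)..t, momResp ω₂ lam β γ T N x s) ∧
        (∀ (x : Fin (N + 1)) (t : ℝ), 0 ≤ t →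
          momResp ω₂ lam β γ T N x t = (if (x : ℕ) = 0 then T else 0) +
            ∫ s in (0 : ℝ)..t, (-(ω₂ * posResp ω₂ lam β γ T N x s) - lam * cubeResp ω₂ lam β γ T N x s +
              (∑ b : Fin N, ((if (b : ℕ) = (x : ℕ) then bondForceResp ω₂ lam β γ T N b s else 0) -
                (if (b : ℕ) + 1 = (x : ℕ) then bondForceResp ω₂ lam β γ T N b s else 0))) -
              γ * ((if (x : ℕ) = 0 then 1 else 0) + (if (x : ℕ) = N then 1 else 0)) *
                momResp ω₂ lam β γ T N x s))) →
      ((∀ x : Fin (N + 1), Continuous (momResp ω₂ lam β γ T N x) ∧ Continuous (posResp ω₂ lam β γ T N x) ∧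
          Continuous (cubeResp ω₂ lam β γ T N x)) ∧
        (∀ b : Fin N, Continuous (stretchCubeResp ω₂ lam β γ T N b)) ∧
        (∀ (b : Fin N) (t : ℝ), bondForceResp ω₂ lam β γ T N b t =
          posResp ω₂ lam β γ T N b.succ t - posResp ω₂ lam β γ T N b.castSucc t +
            β * stretchCubeResp ω₂ lam β γ T N b t) ∧
        (∃ C c : ℝ, 0 < c ∧ ∀ t : ℝ, 0 ≤ t →
          (∀ x : Fin (N + 1), |momResp ω₂ lam β γ T N x t| ≤ C * Real.exp (-c * t) ∧
              |posResp ω₂ lam β γ T N x t| ≤ C * Real.exp (-c * t) ∧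
              |cubeResp ω₂ lam β γ T N x t| ≤ C * Real.exp (-c * t)) ∧
          (∀ b : Fin N, |stretchCubeResp ω₂ lam β γ T N b t| ≤ C * Real.exp (-c * t)))) →
      (∀ x : Fin (N + 1),
          (∑ b : Fin N, if (b : ℕ) + 1 = (x : ℕ) then harmFlux ω₂ lam β γ T N b else 0) +
              (if (x : ℕ) = 0 then T ^ 2 / 2 else 0) =
            (∑ b : Fin N, if (b : ℕ) = (x : ℕ) then harmFlux ω₂ lam β γ T N b else 0) +
              siteWork ω₂ lam β γ T N x +
              γ * ((if (x : ℕ) = 0 then 1 else 0) + (if (x : ℕ) = N then 1 else 0)) *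
                ∫ t in Ioi (0 : ℝ), momResp ω₂ lam β γ T N x t ^ 2) ∧
        (∀ b : Fin N, harmFlux ω₂ lam β γ T N b ≤
          cohEnergy ω₂ lam β γ T N b.castSucc + cohEnergy ω₂ lam β γ T N b.succ) := by
  intro ω₂ lam β γ hω _ _ _ T _ N hD hR
  obtain ⟨hn, hm⟩ := hD
  obtain ⟨hcont, hdc, hF, C, r, hr, hdec⟩ := hR
  refine ⟨fun x => siteBalance_of_duhamel hn hm (fun y => (hcont y).1) (fun y => (hcont y).2.1)
    (fun y => (hcont y).2.2) hdc hF hr (fun y t ht => ((hdec t ht).1 y).1) (fun y t ht => ((hdec t ht).1 y).2.1)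
    (fun y t ht => ((hdec t ht).1 y).2.2) (fun b' t ht => (hdec t ht).2 b') (fun _ => rfl) (fun _ => rfl) x,
    fun b => harmFlux_le_energy_of_decay hω.le (fun y => (hcont y).1) (fun y => (hcont y).2.1) hr
      (fun y t ht => ((hdec t ht).1 y).1) (fun y t ht => ((hdec t ht).1 y).2.1)
      (eD := cohEnergyDensity ω₂ lam β γ T N) (fun _ _ => rfl) b⟩

end Summit.AtomisticToContinuum.FouriersLaw.Theorems.CoherentDephasing.SiteBookkeeping

end
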